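import Mathlib
import Summits.Ventures.PercRepro2.SwOutCrossGenThm

/-!
# The fibre data of ANY connected dropped component, I: the fibre, the link graph, the
classification of the mixed levels (blind cell PercRepro2, night-4 g23, 2026-08-28;
proofs/NIGHT4-G23.md §9)

`k` dropped vertices `V` (finite, non-empty), each joined to `u`, with a CONNECTED cross-edge graph
`G : SimpleGraph V`, no pieces.  The fibre `FibK V = (uP, c, e)`: the u-edge bits, the colour of
every cross edge, the outside bits.  The LINK GRAPH `Glink G w` on `Option V` (`none` = `u`): the
red cross edges and the red u-edges; a vertex is ATTACHED when linked to `u` (`att`), two vertices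
are RED-LINKED when linked (`rlink`); the flip gives the blue side.  The generic slab injection,
its retraction, the label (outside bits, red links between red ports, blue links between blue
ports) with the restricted partition order, and the lower core points (everything dropped, red
outside edges).  The five axioms of `FibreData` are THEOREMS here — the classification of the mixed
levels uses the connectivity of `G` (a walk between a vertex with a red u-edge and one with a blue
u-edge crosses an edge whose colour contradicts the two-sided leak constraints) — so
**`card_le_crossK`** is the abstract theorem of boundary (iv) for every connected pure dropped
component.
-/

namespace Summit.Ventures.PercRepro2

namespace CrossArm

open Classical

variable {V : Type*}

/-- The fibre points: the u-edge bits, the cross-edge colours, the outside bits. -/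
abbrev FibK (V : Type*) := (V → Bool) × (Sym2 V → Bool) × (V → Bool)

/-- The flip. -/
def FibK.flip (w : FibK V) : FibK V := (fun i => !w.1 i, fun s => !w.2.1 s, fun i => !w.2.2 i)

/-- The flip is an involution. -/
lemma FibK.flip_flip (w : FibK V) : w.flip.flip = w := by
  obtain ⟨uP, c, e⟩ := w
  simp only [FibK.flip, Bool.not_not]

section Link

variable (G : SimpleGraph V)

/-- The link graph on `Option V` (`none` = `u`): the red cross edges and the red u-edges. -/
def Glink (w : FibK V) : SimpleGraph (Option V) where
  Adj x y :=
    match x, y with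
    | some i, some j => G.Adj i j ∧ w.2.1 s(i, j) = true
    | none, some i => w.1 i = true
    | some i, none => w.1 i = true
    | none, none => False
  symm := ⟨by
    intro x y h
    cases x with
    | none => cases y with
      | none => exact h
      | some j => exact h
    | some i => cases y with
      | none => exact h
      | some j => exact ⟨h.1.symm, by rw [Sym2.eq_swap]; exact h.2⟩⟩
  loopless := ⟨by
    intro x h
    cases x with
    | none => exact h
    | some i => exact G.irrefl h.1⟩

/-- A vertex is attached when linked to `u`. -/
def att (w : FibK V) (i : V) : Prop := (Glink G w).Reachable (some i) none

/-- Two vertices are red-linked when linked in the link graph. -/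
def rlink (w : FibK V) (i j : V) : Prop := (Glink G w).Reachable (some i) (some j)

/-- The fibre atoms: the dropped vertices and the cross edges. -/
abbrev AtomK (V : Type*) := V ⊕ Sym2 V

/-- The red fibre atoms: the attached vertices and the red cross edges at an attached end. -/
noncomputable def redK (w : FibK V) : AtomK V → Bool
  | Sum.inl i => decide (att G w i)
  | Sum.inr s => decide (s ∈ G.edgeSet ∧ w.2.1 s = true ∧ ∃ i ∈ s, att G w i)

/-- The red-side leak: an attached vertex with red outside edges. -/
noncomputable def leakK (w : FibK V) : Bool := decide (∃ i, att G w i ∧ w.2.2 i = false)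

/-- The core points: uniform u-edges with matching outside bits. -/
noncomputable def coreK (w : FibK V) : Bool :=
  decide (∃ b, (∀ i, w.1 i = b) ∧ ∀ i, w.2.2 i = b)

/-- The labels: outside bits, red links between red ports, blue links between blue ports. -/
abbrev LabelK (V : Type*) := (V → Bool) × (V → V → Prop) × (V → V → Prop)

/-- The label of a point. -/
def labelK (w : FibK V) : LabelK V :=
  (w.2.2, fun i j => w.2.2 i = false ∧ w.2.2 j = false ∧ rlink G w i j,
    fun i j => w.2.2 i = true ∧ w.2.2 j = true ∧ rlink G w.flip i j)

/-- The restricted partition order: outside bits no larger, red links between red ports kept,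
blue links between blue ports of the better point already present. -/
def BetterK (l' l : LabelK V) : Prop :=
  (∀ i, l.1 i = false → l'.1 i = false) ∧ (∀ i j, l.2.1 i j → l'.2.1 i j) ∧
    ∀ i j, l'.2.2 i j → l.2.2 i j

/-- `BetterK` is reflexive. -/
lemma BetterK_refl (l : LabelK V) : BetterK l l := ⟨fun _ h => h, fun _ _ h => h, fun _ _ h => h⟩

/-- The generic slab injection: flip the structure, keep the outside bits of the unattached vertices
and clear those of the attached ones; the all-dropped point with all outside edges blue goes to all
red. -/
noncomputable def psiK (w : FibK V) : FibK V :=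
  if (∀ i, w.1 i = false) ∧ ∀ i, w.2.2 i = true then
    (fun _ => true, fun s => !w.2.1 s, fun _ => false)
  else
    (fun i => !w.1 i, fun s => !w.2.1 s, fun i => w.2.2 i && !decide (att G w i))

/-- The retraction of the slab injection. -/
noncomputable def psiInvK (v : FibK V) : FibK V :=
  if (∀ i, v.1 i = true) ∧ ∀ i, v.2.2 i = false then
    (fun _ => false, fun s => !v.2.1 s, fun _ => true)
  else
    (fun i => !v.1 i, fun s => !v.2.1 s,
      fun i => v.2.2 i || decide (att G (fun i => !v.1 i, fun s => !v.2.1 s, fun _ => true) i))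

/-- The lower core points: everything dropped with red outside edges. -/
noncomputable def core0K [Fintype V] [DecidableEq V] : Finset (FibK V) :=
  Finset.univ.filter fun w => (∀ i, w.1 i = false) ∧ ∀ i, w.2.2 i = false

end Link

section Lemmas

variable (G : SimpleGraph V)

/-- The link graph depends only on the u-edge bits and the cross-edge colours. -/
lemma Glink_congr {w w' : FibK V} (h1 : w.1 = w'.1) (h2 : w.2.1 = w'.2.1) :
    Glink G w = Glink G w' := by
  obtain ⟨uP, c, e⟩ := w
  obtain ⟨uP', c', e'⟩ := w'
  simp only at h1 h2
  subst h1 h2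
  rfl

/-- Attachment depends only on the u-edge bits and the cross-edge colours. -/
lemma att_congr {w w' : FibK V} (h1 : w.1 = w'.1) (h2 : w.2.1 = w'.2.1) (i : V) :
    att G w i ↔ att G w' i := by
  unfold att
  rw [Glink_congr G h1 h2]

/-- A vertex with a red u-edge is attached. -/
lemma att_of_uP {w : FibK V} {i : V} (h : w.1 i = true) : att G w i :=
  SimpleGraph.Adj.reachable (show (Glink G w).Adj (some i) none from h)

/-- A vertex joined by a red cross edge to an attached vertex is attached. -/
lemma att_of_adj {w : FibK V} {i j : V} (hij : G.Adj i j) (hc : w.2.1 s(i, j) = true)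
    (hj : att G w j) : att G w i :=
  SimpleGraph.Reachable.trans
    (SimpleGraph.Adj.reachable (show (Glink G w).Adj (some i) (some j) from ⟨hij, hc⟩)) hj

/-- Without red u-edges nothing reaches `u` in the link graph (walk form). -/
lemma eq_none_of_walk {w : FibK V} (h : ∀ i, w.1 i = false) :
    ∀ {x y : Option V}, (Glink G w).Walk x y → y = none → x = none := by
  intro x y p
  induction p with
  | nil => intro hy; exact hy
  | @cons x y z hadj _ ih =>
    intro hz
    have hy := ih hz
    rw [hy] at hadj
    cases x with
    | none => exact absurd hadj ((Glink G w).loopless.irrefl none)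
    | some i =>
      have : w.1 i = true := hadj
      rw [h i] at this
      exact Bool.noConfusion this

/-- Without red u-edges nothing is attached. -/
lemma not_att_of_uP_false {w : FibK V} (h : ∀ i, w.1 i = false) (i : V) : ¬ att G w i :=
  fun hatt => Option.some_ne_none i (eq_none_of_walk G h hatt.some rfl)

/-- An unattached vertex has a blue u-edge. -/
lemma uP_eq_false_of_not_att {w : FibK V} {i : V} (h : ¬ att G w i) : w.1 i = false := by
  cases hu : w.1 i with
  | false => rfl
  | true => exact absurd (att_of_uP G hu) h

/-- Along a walk from a vertex satisfying `P` to one not satisfying it, some edge leaves `P`. -/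
lemma exists_adj_of_walk (P : V → Prop) : ∀ {a b : V}, G.Walk a b → P a → ¬ P b →
    ∃ x y, G.Adj x y ∧ P x ∧ ¬ P y := by
  intro a b p
  induction p with
  | nil => intro ha hb; exact absurd ha hb
  | @cons x y z hadj _ ih =>
    intro hx hz
    by_cases hy : P y
    · exact ih hy hz
    · exact ⟨x, y, hadj, hx, hy⟩

/-- **The classification of the mixed levels**: a point without red-side and without blue-side
leak is core (the cross-edge graph being connected). -/
lemma coreK_of_noLeak [Nonempty V] (hG : G.Connected) (w : FibK V)
    (hr : leakK G w = false) (hb : leakK G w.flip = false) : coreK w = true := by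
  simp only [leakK, decide_eq_false_iff_not, not_exists, not_and] at hr hb
  simp only [coreK, decide_eq_true_eq]
  -- the two constraints
  have hr' : ∀ i, att G w i → w.2.2 i = true := fun i h => by
    cases he : w.2.2 i with
    | true => rfl
    | false => exact absurd he (hr i h)
  have hb' : ∀ i, att G w.flip i → w.2.2 i = false := fun i h => by
    have := hb i h
    cases he : w.2.2 i with
    | false => rfl
    | true =>
      exfalso
      apply this
      show (!w.2.2 i) = false
      rw [he]; rfl
  -- the u-edge bits are constant
  have hconst : ∀ i j, w.1 i = true → w.1 j = true := by
    intro i j hi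
    by_contra hj
    have hj' : w.1 j = false := by cases h : w.1 j with | false => rfl | true => exact absurd h hj
    obtain ⟨x, y, hxy, hx, hy⟩ :=
      exists_adj_of_walk G (fun v => w.1 v = true) (hG.preconnected i j).some hi (by
        intro h; rw [hj'] at h; exact Bool.noConfusion h)
    have hy' : w.1 y = false := by cases h : w.1 y with | false => rfl | true => exact absurd h hy
    cases hc : w.2.1 s(x, y) with
    | true =>
      -- `y` is attached through the red edge, and blue-attached directly
      have h1 := hr' y (att_of_adj G hxy.symm (by rw [Sym2.eq_swap]; exact hc) (att_of_uP G hx))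
      have h2 := hb' y (att_of_uP G (show w.flip.1 y = true by simp [FibK.flip, hy']))
      rw [h1] at h2; exact Bool.noConfusion h2
    | false =>
      -- `x` is attached directly, and blue-attached through the blue edge
      have h1 := hr' x (att_of_uP G hx)
      have h2 := hb' x (att_of_adj G (w := w.flip) hxy (by simp [FibK.flip, hc])
        (att_of_uP G (show w.flip.1 y = true by simp [FibK.flip, hy'])))
      rw [h1] at h2; exact Bool.noConfusion h2
  obtain ⟨i₀⟩ := ‹Nonempty V›
  cases h₀ : w.1 i₀ with
  | true =>
    refine ⟨true, fun i => hconst i₀ i h₀, fun i => hr' i (att_of_uP G (hconst i₀ i h₀))⟩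
  | false =>
    have hall : ∀ i, w.1 i = false := by
      intro i
      cases h : w.1 i with
      | false => rfl
      | true => rw [hconst i i₀ h] at h₀; exact Bool.noConfusion h₀
    refine ⟨false, hall, fun i => hb' i (att_of_uP G (show w.flip.1 i = true by simp [FibK.flip, hall i]))⟩

/-- Core points do not leak on the red side. -/
lemma leakK_core (w : FibK V) (hc : coreK w = true) : leakK G w = false := by
  simp only [coreK, decide_eq_true_eq] at hc
  simp only [leakK, decide_eq_false_iff_not, not_exists, not_and]
  obtain ⟨b, huP, he⟩ := hc
  intro i hatt
  cases b with
  | true => rw [he i]; decide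
  | false => exact absurd hatt (not_att_of_uP_false G huP i)

/-- The flip of a core point is core. -/
lemma coreK_flip (w : FibK V) (hc : coreK w = true) : coreK w.flip = true := by
  simp only [coreK, decide_eq_true_eq] at hc ⊢
  obtain ⟨b, huP, he⟩ := hc
  exact ⟨!b, fun i => by simp [FibK.flip, huP i], fun i => by simp [FibK.flip, he i]⟩

/-- Core points do not leak on the blue side. -/
lemma leakK_flip_core (w : FibK V) (hc : coreK w = true) : leakK G w.flip = false :=
  leakK_core G _ (coreK_flip w hc)

end Lemmas

end CrossArm

end Summit.Ventures.PercRepro2
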